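import Summits.CriticalPhenomena.PercolationContinuityZ3.Theorems.Transplant.SiteMetaA2Anti
import HarnessLib

/-!
# SITE percolation: the world functional `H_{G[U]}(v) = Cov_{G[U]}(g(C_x), 1{v ↔ S})` and the two-source inequality A2^H / (Htw)
# modulo the SITE one-source bounds (WP4 of P1-SITE-Z3 §12; site twin of `CovTau.BfS…` and `CovTauA2H`)

builds on p205010 (kernel theorem, internal audit signed; external expert review pending).

* `SiteCovTau.cfS q U S v = μ_{G[U]}(v ↔ S)` (some marker of `S` lies in the site cluster of `v` inside `U`), `tfS q U x g = E_{G[U]} g(C_x)`,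
  **`BfS q U x S v g = Cov_{G[U]}(g(C_x), 1{v ↔ S})`** (normalised weights) — the world functional `H` of the conditioned slack hierarchy,
  site form (vertex-cluster functional `g`);
* `BfS_nonneg` (Harris), `BfS_eq_zero_of_not_mem` (`v ∉ U`; no `v ∉ S` needed in site), `BfS_eq_zero_of_not_mem_owner` (`x ∉ U`);
* **`a2H_of_star`**, **`p1H_of_star`**, `p1H_univ_of_star` — (K9) A2^H and its diagonal (Htw) for SITE percolation, from `SiteCovTau.metaA2`
  (p212506 + `SiteMetaA2Anti`), GIVEN the two site one-source bounds as hypotheses with their exact Lean shapes: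
  (★^H)_site `hstar : Yw(BfS) N · Mav S ∅ ≤ Mav S N · BfS` and (Y^H ≤ H)_site `hYB : Yw(BfS) {u} ≤ BfS` in every sub-world — the WP3 targets.
Definitions + proofs (`--supports stmt-CriticalPhenomena-4575 --as helper`); no named facts, no sorries.
[cite: VandenbergHaggstromKahn2005, Thm. 1.1 (pp. 3–5), Thm. 1.4 (p. 7), §1 p. 6 (Harris)] [cite: KozmaNitzan2024, Conj. 1 (p. 3)]
-/

noncomputable section

namespace Summit.CriticalPhenomena.PercolationContinuityZ3.Theorems.Transplant

namespace SiteCovTau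

open Literature.Probability.Percolation
open Literature.Probability.Percolation.BHK2006 (weight weight_nonneg harris)
open Literature.Probability.Percolation.DecisionTree (ind ind_of_mem ind_of_not_mem ind_nonneg)
open SiteBHK (sC sD sC_mono sD_decreasing sC_eq_empty_of_notMem)
open scoped Classical

variable {V : Type*} [Fintype V] (Γ : SimpleGraph V)

/-! ### The world functional `H` (site) -/

/-- `μ_{G[U]}(v ↔ S)` (site): some marker of `S` lies in the site cluster of `v` inside `U` — the complement of `SiteBHK.sD Γ U v S`.
[cite: VandenbergHaggstromKahn2005, §1 p. 3] -/
def cfS (q : V → ℝ) (U : Finset V) (S : Set V) (v : V) : ℝ :=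
  ∑ ω, weight q ω * ind (sD Γ U v S)ᶜ ω

/-- `E_{G[U]} g(C_x)` (site). [folklore] -/
def tfS (q : V → ℝ) (U : Finset V) (x : V) (g : Set V → ℝ) : ℝ :=
  ∑ ω, weight q ω * g (sC Γ U x ω)

/-- **`H_{G[U]}(v) = Cov_{G[U]}(g(C_x), 1{v ↔ S})`** (site; normalised weights). [cite: VandenbergHaggstromKahn2005, §1 p. 6] -/
def BfS (q : V → ℝ) (U : Finset V) (x : V) (S : Set V) (v : V) (g : Set V → ℝ) : ℝ :=
  (∑ ω, weight q ω * (g (sC Γ U x ω) * ind (sD Γ U v S)ᶜ ω)) - tfS Γ q U x g * cfS Γ q U S v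

variable {Γ}

/-- **`H ≥ 0` (Harris)**: `g(C_x)` and `1{v ↔ S}` are increasing. [cite: VandenbergHaggstromKahn2005, §1 p. 6] -/
theorem BfS_nonneg {q : V → ℝ} (hq0 : ∀ a, 0 ≤ q a) (hq1 : ∀ a, q a ≤ 1) (hm : ∑ ω, weight q ω = 1)
    (U : Finset V) (x : V) (S : Set V) (v : V) {g : Set V → ℝ} (hg : Monotone g) (hg0 : ∀ C, 0 ≤ g C) :
    0 ≤ BfS Γ q U x S v g := by
  have h := harris hq0 hq1 (f := fun ω => g (sC Γ U x ω)) (g := ind (sD Γ U v S)ᶜ)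
    (fun _ => hg0 _) (fun _ => ind_nonneg _ _) (fun a b hab => hg (sC_mono U x hab))
    (by
      intro a b hab
      by_cases ha : a ∈ (sD Γ U v S)ᶜ
      · have hb : b ∈ (sD Γ U v S)ᶜ := fun hb => ha (sD_decreasing hab hb)
        rw [ind_of_mem ha, ind_of_mem hb]
      · rw [ind_of_not_mem ha]; exact ind_nonneg _ _)
  rw [hm, one_mul] at h
  unfold BfS tfS cfS
  linarith

/-- In a world not containing `v` the covariance `H` vanishes (`C_v = ∅`, so `v ↮ S`). [folklore] -/
theorem BfS_eq_zero_of_not_mem (q : V → ℝ) {U : Finset V} (x : V) (S : Set V) {v : V} (hv : v ∉ U)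
    (g : Set V → ℝ) : BfS Γ q U x S v g = 0 := by
  unfold BfS tfS cfS
  have h0 : ∀ ω : Set V, ind (sD Γ U v S)ᶜ ω = 0 := fun ω =>
    ind_of_not_mem fun h => h fun s _ hs => hv hs.1.2
  simp only [h0, mul_zero, Finset.sum_const_zero]; ring

/-- In a world not containing the owner `x` the covariance `H` vanishes (`C_x = ∅`; normalised weights). [folklore] -/
theorem BfS_eq_zero_of_not_mem_owner (q : V → ℝ) (hm : ∑ ω, weight q ω = 1) {U : Finset V} {x : V} (hx : x ∉ U)
    (S : Set V) (v : V) (g : Set V → ℝ) : BfS Γ q U x S v g = 0 := by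
  unfold BfS tfS cfS
  have h0 : ∀ ω : Set V, sC Γ U x ω = ∅ := fun ω =>
    Set.eq_empty_of_forall_notMem fun y hy => hx hy.1.2
  have e : ∑ ω, weight q ω * (g (sC Γ U x ω) * ind (sD Γ U v S)ᶜ ω) = g ∅ * ∑ ω, weight q ω * ind (sD Γ U v S)ᶜ ω := by
    rw [Finset.mul_sum]
    exact Finset.sum_congr rfl fun ω _ => by rw [h0]; ring
  have e' : ∑ ω, weight q ω * g (sC Γ U x ω) = g ∅ := by
    simp only [h0]
    rw [← Finset.sum_mul, hm, one_mul]
  rw [e, e']; ring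

/-! ### A2^H and (Htw), site, modulo the one-source bounds -/

/-- **(K9) A2^H for SITE percolation, modulo the site one-source bounds** (★^H)_site and (Y^H ≤ H)_site (the WP3 targets, as
hypotheses `hstar`, `hYB` in every sub-world): for a marker set `S`, a monotone vertex-cluster functional `g ≥ 0`, and all `N, N' ⊆ U`: `E_S(N)·Y^H(N') ≤ M_S(N ∪ N')·X^H(N ∩ N')`. [cite: VandenbergHaggstromKahn2005, Thm. 1.1 (pp. 3–5), Thm. 1.4 (p. 7)] -/
theorem a2H_of_star (q : V → ℝ) (hq0 : ∀ a, 0 ≤ q a) (hq1 : ∀ a, q a ≤ 1) (hm : ∑ ω, weight q ω = 1)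
    (x v o : V) (S : Set V) {g : Set V → ℝ} (hg : Monotone g) (hg0 : ∀ C, 0 ≤ g C) (U : Finset V)
    (hstar : ∀ U' ⊆ U, ∀ N : Set V, N ⊆ ↑U' →
      Yw Γ q U' x (fun U'' => BfS Γ q U'' x S v g) N * Mav Γ q U' S v ∅ ≤ Mav Γ q U' S v N * BfS Γ q U' x S v g)
    (hYB : ∀ U' ⊆ U, ∀ u : V, Yw Γ q U' x (fun U'' => BfS Γ q U'' x S v g) {u} ≤ BfS Γ q U' x S v g)
    {N N' : Set V} (hNU : N ⊆ ↑U) (hN'U : N' ⊆ ↑U) :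
    Eav Γ q U S o v N * Yw Γ q U x (fun U' => BfS Γ q U' x S v g) N' ≤
      Mav Γ q U S v (N ∪ N') * Xw Γ q U x S o v (fun U' => BfS Γ q U' x S v g) (N ∩ N') :=
  metaA2 q hq0 hq1 hm x o v S (F := fun U' => BfS Γ q U' x S v g)
    (fun U' => BfS_nonneg hq0 hq1 hm U' x S v hg hg0) (fun _ hv => BfS_eq_zero_of_not_mem q x S hv g)
    (fun _ hx => BfS_eq_zero_of_not_mem_owner q hm hx S v g) U hstar hYB hNU hN'U

/-- **(Htw)_site = the diagonal of A2^H, modulo the site one-source bounds**: for `Y ⊆ U`, `E_S(Y)·Y^H(Y) ≤ M_S(Y)·X^H(Y)`.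
[cite: VandenbergHaggstromKahn2005, Thm. 1.1 (pp. 3–5), Thm. 1.4 (p. 7)] -/
theorem p1H_of_star (q : V → ℝ) (hq0 : ∀ a, 0 ≤ q a) (hq1 : ∀ a, q a ≤ 1) (hm : ∑ ω, weight q ω = 1)
    (x v o : V) (S : Set V) {g : Set V → ℝ} (hg : Monotone g) (hg0 : ∀ C, 0 ≤ g C) (U : Finset V)
    (hstar : ∀ U' ⊆ U, ∀ N : Set V, N ⊆ ↑U' →
      Yw Γ q U' x (fun U'' => BfS Γ q U'' x S v g) N * Mav Γ q U' S v ∅ ≤ Mav Γ q U' S v N * BfS Γ q U' x S v g)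
    (hYB : ∀ U' ⊆ U, ∀ u : V, Yw Γ q U' x (fun U'' => BfS Γ q U'' x S v g) {u} ≤ BfS Γ q U' x S v g)
    {Y : Set V} (hY : Y ⊆ ↑U) :
    Eav Γ q U S o v Y * Yw Γ q U x (fun U' => BfS Γ q U' x S v g) Y ≤
      Mav Γ q U S v Y * Xw Γ q U x S o v (fun U' => BfS Γ q U' x S v g) Y := by
  have h := a2H_of_star q hq0 hq1 hm x v o S hg hg0 U hstar hYB hY hY
  simpa only [Set.union_self, Set.inter_self] using h

/-- **(Htw)_site on the whole graph** (`U = univ`), modulo the site one-source bounds. [cite: VandenbergHaggstromKahn2005, Thm. 1.1 (pp. 3–5)] -/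
theorem p1H_univ_of_star (q : V → ℝ) (hq0 : ∀ a, 0 ≤ q a) (hq1 : ∀ a, q a ≤ 1) (hm : ∑ ω, weight q ω = 1)
    (x v o : V) (S : Set V) {g : Set V → ℝ} (hg : Monotone g) (hg0 : ∀ C, 0 ≤ g C)
    (hstar : ∀ U' : Finset V, ∀ N : Set V, N ⊆ ↑U' →
      Yw Γ q U' x (fun U'' => BfS Γ q U'' x S v g) N * Mav Γ q U' S v ∅ ≤ Mav Γ q U' S v N * BfS Γ q U' x S v g)
    (hYB : ∀ U' : Finset V, ∀ u : V, Yw Γ q U' x (fun U'' => BfS Γ q U'' x S v g) {u} ≤ BfS Γ q U' x S v g)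
    (Y : Set V) :
    Eav Γ q Finset.univ S o v Y * Yw Γ q Finset.univ x (fun U' => BfS Γ q U' x S v g) Y ≤
      Mav Γ q Finset.univ S v Y * Xw Γ q Finset.univ x S o v (fun U' => BfS Γ q U' x S v g) Y :=
  p1H_of_star q hq0 hq1 hm x v o S hg hg0 Finset.univ (fun U' _ => hstar U') (fun U' _ => hYB U') (by simp)

end SiteCovTau

end Summit.CriticalPhenomena.PercolationContinuityZ3.Theorems.Transplant
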